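import Mathlib
import Summits.Ventures.PercRepro.TriangleCapRowGeneral

/-!
# PercRepro — the star plus `t` disjoint leaf edges, for every `k ≥ 2t + 1`: the general row
`m = k − 1 + t` is EXACT above the threshold (p3, gen 31; part 10 — the companion of TriangleCapRowGeneral)

* `starMatch k t : SimpleGraph (Fin k)` — the centre `0` is adjacent to every other vertex, and the leaves
  `2s − 1, 2s ≤ 2t` (the same `(i + 1) / 2`) are adjacent to each other (the windmill `W_t` at `k = 2t + 1`,
  `starPlusThree` / `starPlusFour` at `t = 3, 4`);
* `k4mFree_starMatch` — a `4`-set with the centre carries `3 + 2 + 2 + 1 ≤ 8` ordered adjacent pairs (three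
  distinct leaves cannot all have their twin among them), one without it `≤ 4` (TriangleCapWindmill's argument);
* the degrees: `k − 1` at the centre, `2` at the leaves `1 … 2t`, `1` beyond; `cherries_starMatch = C(k − 1, 2) + 2t`,
  `sum_deg_starMatch = 2k + 2t − 2`, `card_edges_starMatch = k − 1 + t`;
* **`exists_k4mFree_row_general`** — for every `k ≥ 2t + 1` a `K₄⁻`-free graph on `Fin k` with `k − 1 + t` edges
  and `C(k − 1, 2) + 2t` cherries; **`row_general_exact`** — for `t ≥ 4` and `t² + 6 ≤ 2k + t` the `K₄⁻`-free
  cherry maximum at `(k, k − 1 + t)` is exactly `C(k − 1, 2) + 2t`.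

Axioms: standard.
-/

namespace PercRepro

namespace TriangleCap

namespace C047

open Finset

/-- The star with centre `0` plus the `t` disjoint leaf edges `{1, 2}, {3, 4}, …, {2t − 1, 2t}` on `Fin k`. -/
def starMatch (k t : ℕ) : SimpleGraph (Fin k) where
  Adj i j := i ≠ j ∧ (i.val = 0 ∨ j.val = 0 ∨
    (i.val ≠ 0 ∧ i.val ≤ 2 * t ∧ j.val ≠ 0 ∧ j.val ≤ 2 * t ∧ (i.val + 1) / 2 = (j.val + 1) / 2))
  symm := ⟨fun i j h => by
    obtain ⟨h1, h2⟩ := h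
    refine ⟨h1.symm, ?_⟩
    rcases h2 with h | h | ⟨h3, h4, h5, h6, h7⟩
    · exact Or.inr (Or.inl h)
    · exact Or.inl h
    · exact Or.inr (Or.inr ⟨h5, h6, h3, h4, h7.symm⟩)⟩
  loopless := ⟨fun i h => h.1 rfl⟩

/-- Adjacency in `starMatch k t` is decidable. -/
instance decidableRelStarMatch (k t : ℕ) : DecidableRel (starMatch k t).Adj :=
  fun i j => inferInstanceAs (Decidable (i ≠ j ∧ (i.val = 0 ∨ j.val = 0 ∨
    (i.val ≠ 0 ∧ i.val ≤ 2 * t ∧ j.val ≠ 0 ∧ j.val ≤ 2 * t ∧ (i.val + 1) / 2 = (j.val + 1) / 2))))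

/-- `(starMatch k t).Adj i j` unfolded. -/
theorem starMatch_adj (k t : ℕ) (i j : Fin k) :
    (starMatch k t).Adj i j ↔ i ≠ j ∧ (i.val = 0 ∨ j.val = 0 ∨
      (i.val ≠ 0 ∧ i.val ≤ 2 * t ∧ j.val ≠ 0 ∧ j.val ≤ 2 * t ∧ (i.val + 1) / 2 = (j.val + 1) / 2)) := Iff.rfl

/-- Two vertices other than `u` in the twin class of `u` coincide. -/
theorem starMatch_twin_unique {k : ℕ} {u x y : Fin k} (hxu : x ≠ u) (hyu : y ≠ u)
    (hpx : (x.val + 1) / 2 = (u.val + 1) / 2) (hpy : (y.val + 1) / 2 = (u.val + 1) / 2) : x = y := by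
  apply Fin.ext
  have hxu' : x.val ≠ u.val := fun h => hxu (Fin.ext h)
  have hyu' : y.val ≠ u.val := fun h => hyu (Fin.ext h)
  omega

/-- The vertices of `S` with value `0`: at most one. -/
theorem starMatch_card_filter_val_zero_le_one (k : ℕ) (S : Finset (Fin k)) :
    (S.filter (fun x : Fin k => x.val = 0)).card ≤ 1 := by
  rw [card_le_one]
  intro a ha b hb
  rw [mem_filter] at ha hb
  exact Fin.ext (ha.2.trans hb.2.symm)

/-- The twins of a leaf `u` inside `S`: at most one. -/
theorem starMatch_card_filter_twin_le_one (k t : ℕ) (S : Finset (Fin k)) (u : Fin k) :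
    (S.filter (fun x : Fin k => x ≠ u ∧ x.val ≠ 0 ∧ x.val ≤ 2 * t ∧
      (x.val + 1) / 2 = (u.val + 1) / 2)).card ≤ 1 := by
  rw [card_le_one]
  intro a ha b hb
  rw [mem_filter] at ha hb
  exact starMatch_twin_unique ha.2.1 hb.2.1 ha.2.2.2.2 hb.2.2.2.2

/-- The neighbours of a non-centre vertex `u` inside `S` are the centre (if present) and its twin (if present). -/
theorem filter_adj_starMatch_leaf_subset (k t : ℕ) (S : Finset (Fin k)) (u : Fin k) (hu : u.val ≠ 0) :
    S.filter (fun x => (starMatch k t).Adj u x) ⊆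
      S.filter (fun x : Fin k => x.val = 0) ∪
        S.filter (fun x : Fin k => x ≠ u ∧ x.val ≠ 0 ∧ x.val ≤ 2 * t ∧
          (x.val + 1) / 2 = (u.val + 1) / 2) := by
  intro x hx
  rw [mem_filter, starMatch_adj] at hx
  obtain ⟨hxS, hne, h⟩ := hx
  rw [mem_union, mem_filter, mem_filter]
  rcases h with h | h | ⟨-, -, h3, h4, h5⟩
  · exact absurd h hu
  · exact Or.inl ⟨hxS, h⟩
  · exact Or.inr ⟨hxS, hne.symm, h3, h4, h5.symm⟩

/-- A non-centre vertex has at most `2` neighbours inside any `S`. -/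
theorem card_filter_adj_starMatch_leaf_le_two (k t : ℕ) (S : Finset (Fin k)) (u : Fin k) (hu : u.val ≠ 0) :
    (S.filter (fun x => (starMatch k t).Adj u x)).card ≤ 2 :=
  (card_le_card (filter_adj_starMatch_leaf_subset k t S u hu)).trans ((card_union_le _ _).trans
    (Nat.add_le_add (starMatch_card_filter_val_zero_le_one k S) (starMatch_card_filter_twin_le_one k t S u)))

/-- A non-centre vertex with no twin inside `S` has at most `1` neighbour inside `S`. -/
theorem card_filter_adj_starMatch_leaf_le_one (k t : ℕ) (S : Finset (Fin k)) (u : Fin k) (hu : u.val ≠ 0)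
    (hno : ∀ x ∈ S, x ≠ u → x.val ≠ 0 → x.val ≤ 2 * t → (x.val + 1) / 2 ≠ (u.val + 1) / 2) :
    (S.filter (fun x => (starMatch k t).Adj u x)).card ≤ 1 := by
  have hempty : S.filter (fun x : Fin k => x ≠ u ∧ x.val ≠ 0 ∧ x.val ≤ 2 * t ∧
      (x.val + 1) / 2 = (u.val + 1) / 2) = ∅ := by
    rw [filter_eq_empty_iff]
    intro x hx ⟨h1, h2, h3, h4⟩
    exact hno x hx h1 h2 h3 h4
  calc (S.filter (fun x => (starMatch k t).Adj u x)).card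
      ≤ (S.filter (fun x : Fin k => x.val = 0) ∪
          S.filter (fun x : Fin k => x ≠ u ∧ x.val ≠ 0 ∧ x.val ≤ 2 * t ∧
            (x.val + 1) / 2 = (u.val + 1) / 2)).card :=
        card_le_card (filter_adj_starMatch_leaf_subset k t S u hu)
    _ = (S.filter (fun x : Fin k => x.val = 0)).card := by rw [hempty, union_empty]
    _ ≤ 1 := starMatch_card_filter_val_zero_le_one k S

/-- If `S` has no centre, a non-centre vertex has at most `1` neighbour inside `S`. -/
theorem card_filter_adj_starMatch_leaf_le_one_of_no_centre (k t : ℕ) (S : Finset (Fin k)) (u : Fin k)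
    (hu : u.val ≠ 0) (h0 : ∀ x ∈ S, x.val ≠ 0) :
    (S.filter (fun x => (starMatch k t).Adj u x)).card ≤ 1 := by
  have hempty : S.filter (fun x : Fin k => x.val = 0) = ∅ := by
    rw [filter_eq_empty_iff]
    intro x hx
    exact h0 x hx
  calc (S.filter (fun x => (starMatch k t).Adj u x)).card
      ≤ (S.filter (fun x : Fin k => x.val = 0) ∪
          S.filter (fun x : Fin k => x ≠ u ∧ x.val ≠ 0 ∧ x.val ≤ 2 * t ∧
            (x.val + 1) / 2 = (u.val + 1) / 2)).card :=
        card_le_card (filter_adj_starMatch_leaf_subset k t S u hu)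
    _ = (S.filter (fun x : Fin k => x ≠ u ∧ x.val ≠ 0 ∧ x.val ≤ 2 * t ∧
          (x.val + 1) / 2 = (u.val + 1) / 2)).card := by rw [hempty, empty_union]
    _ ≤ 1 := starMatch_card_filter_twin_le_one k t S u

/-- The centre has at most `|S| − 1` neighbours inside `S`. -/
theorem card_filter_adj_starMatch_centre_le (k t : ℕ) (S : Finset (Fin k)) (c : Fin k) (hc : c ∈ S) :
    (S.filter (fun x => (starMatch k t).Adj c x)).card ≤ S.card - 1 := by
  rw [← card_erase_of_mem hc]
  apply card_le_card
  intro x hx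
  rw [mem_filter, starMatch_adj] at hx
  rw [mem_erase]
  exact ⟨hx.2.1.symm, hx.1⟩

/-- Three distinct vertices cannot all have a twin among themselves. -/
theorem starMatch_not_all_twins {k : ℕ} {a b c : Fin k} (hab : a ≠ b) (hac : a ≠ c) (hbc : b ≠ c)
    (h1 : (a.val + 1) / 2 = (b.val + 1) / 2 ∨ (a.val + 1) / 2 = (c.val + 1) / 2)
    (h2 : (b.val + 1) / 2 = (a.val + 1) / 2 ∨ (b.val + 1) / 2 = (c.val + 1) / 2)
    (h3 : (c.val + 1) / 2 = (a.val + 1) / 2 ∨ (c.val + 1) / 2 = (b.val + 1) / 2) : False := by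
  have hab' : a.val ≠ b.val := fun h => hab (Fin.ext h)
  have hac' : a.val ≠ c.val := fun h => hac (Fin.ext h)
  have hbc' : b.val ≠ c.val := fun h => hbc (Fin.ext h)
  omega

/-- **`starMatch k t` is `K₄⁻`-free.** -/
theorem k4mFree_starMatch (k t : ℕ) : K4mFree (starMatch k t) := by
  intro S hS
  rw [adjPairs_eq_sum]
  by_cases h0 : ∃ c ∈ S, c.val = 0
  · obtain ⟨c, hcS, hc0⟩ := h0
    have hS' : (S.erase c).card = 3 := by rw [card_erase_of_mem hcS, hS]
    obtain ⟨a, b, d, hab, had, hbd, hS'eq⟩ := card_eq_three.mp hS'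
    have hS3 : S = insert c {a, b, d} := by
      rw [← hS'eq, insert_erase hcS]
    have hca : c ∉ ({a, b, d} : Finset (Fin k)) := by
      rw [← hS'eq]; exact notMem_erase c S
    have haS : a ∈ S.erase c := by rw [hS'eq]; simp
    have hbS : b ∈ S.erase c := by rw [hS'eq]; simp
    have hdS : d ∈ S.erase c := by rw [hS'eq]; simp
    have ha0 : a.val ≠ 0 := fun h => (mem_erase.mp haS).1 (Fin.ext (h.trans hc0.symm))
    have hb0 : b.val ≠ 0 := fun h => (mem_erase.mp hbS).1 (Fin.ext (h.trans hc0.symm))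
    have hd0 : d.val ≠ 0 := fun h => (mem_erase.mp hdS).1 (Fin.ext (h.trans hc0.symm))
    have hab' : a ∉ ({b, d} : Finset (Fin k)) := by simp [hab, had]
    have hbd' : b ∉ ({d} : Finset (Fin k)) := by simp [hbd]
    set f : Fin k → ℕ := fun u => (S.filter (fun x => (starMatch k t).Adj u x)).card with hf
    have hsum : ∑ u ∈ S, f u = f c + (f a + (f b + f d)) := by
      rw [hS3, sum_insert hca, sum_insert hab', sum_insert hbd', sum_singleton]
    change ∑ u ∈ S, f u ≤ 8
    rw [hsum]
    have hc : f c ≤ 3 := by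
      have := card_filter_adj_starMatch_centre_le k t S c hcS
      rw [hS] at this
      exact this
    have hA : f a ≤ 2 := card_filter_adj_starMatch_leaf_le_two k t S a ha0
    have hB : f b ≤ 2 := card_filter_adj_starMatch_leaf_le_two k t S b hb0
    have hD : f d ≤ 2 := card_filter_adj_starMatch_leaf_le_two k t S d hd0
    have hone : f a ≤ 1 ∨ f b ≤ 1 ∨ f d ≤ 1 := by
      by_contra hcon
      push Not at hcon
      obtain ⟨h1, h2, h3⟩ := hcon
      have key : ∀ u ∈ S, u.val ≠ 0 → 1 < f u →
          ∃ x ∈ S, x ≠ u ∧ x.val ≠ 0 ∧ x.val ≤ 2 * t ∧ (x.val + 1) / 2 = (u.val + 1) / 2 := by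
        intro u _ hu hlt
        by_contra hno
        push Not at hno
        exact absurd hlt (not_lt.mpr (card_filter_adj_starMatch_leaf_le_one k t S u hu hno))
      have hmemS : ∀ x, x ∈ S ↔ x = c ∨ x = a ∨ x = b ∨ x = d := by
        intro x; rw [hS3]; simp
      obtain ⟨x₁, hx₁S, hx₁a, hx₁0, -, hx₁p⟩ := key a ((hmemS a).mpr (by simp)) ha0 h1
      obtain ⟨x₂, hx₂S, hx₂b, hx₂0, -, hx₂p⟩ := key b ((hmemS b).mpr (by simp)) hb0 h2
      obtain ⟨x₃, hx₃S, hx₃d, hx₃0, -, hx₃p⟩ := key d ((hmemS d).mpr (by simp)) hd0 h3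
      have e₁ : (a.val + 1) / 2 = (b.val + 1) / 2 ∨ (a.val + 1) / 2 = (d.val + 1) / 2 := by
        rcases (hmemS x₁).mp hx₁S with rfl | rfl | rfl | rfl
        · exact absurd hc0 hx₁0
        · exact absurd rfl hx₁a
        · exact Or.inl hx₁p.symm
        · exact Or.inr hx₁p.symm
      have e₂ : (b.val + 1) / 2 = (a.val + 1) / 2 ∨ (b.val + 1) / 2 = (d.val + 1) / 2 := by
        rcases (hmemS x₂).mp hx₂S with rfl | rfl | rfl | rfl
        · exact absurd hc0 hx₂0
        · exact Or.inl hx₂p.symm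
        · exact absurd rfl hx₂b
        · exact Or.inr hx₂p.symm
      have e₃ : (d.val + 1) / 2 = (a.val + 1) / 2 ∨ (d.val + 1) / 2 = (b.val + 1) / 2 := by
        rcases (hmemS x₃).mp hx₃S with rfl | rfl | rfl | rfl
        · exact absurd hc0 hx₃0
        · exact Or.inl hx₃p.symm
        · exact Or.inr hx₃p.symm
        · exact absurd rfl hx₃d
      exact starMatch_not_all_twins hab had hbd e₁ e₂ e₃
    omega
  · push Not at h0
    calc ∑ u ∈ S, (S.filter (fun x => (starMatch k t).Adj u x)).card
        ≤ ∑ u ∈ S, 1 := sum_le_sum (fun u hu =>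
          card_filter_adj_starMatch_leaf_le_one_of_no_centre k t S u (h0 u hu) h0)
      _ = 4 := by rw [sum_const, smul_eq_mul, hS, mul_one]
      _ ≤ 8 := by norm_num

/-- The neighbours of the centre are all the other vertices. -/
theorem filter_adj_starMatch_centre (k t : ℕ) (c : Fin k) (hc : c.val = 0) :
    univ.filter (fun x => (starMatch k t).Adj c x) = univ.erase c := by
  ext x
  rw [mem_filter, mem_erase, starMatch_adj]
  constructor
  · rintro ⟨_, hne, _⟩
    exact ⟨hne.symm, mem_univ _⟩
  · rintro ⟨hne, _⟩
    exact ⟨mem_univ _, hne.symm, Or.inl hc⟩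

/-- The centre has degree `k − 1`. -/
theorem deg_starMatch_centre (k t : ℕ) (c : Fin k) (hc : c.val = 0) : deg (starMatch k t) c = k - 1 := by
  unfold deg
  rw [filter_adj_starMatch_centre k t c hc, card_erase_of_mem (mem_univ _), card_univ, Fintype.card_fin]

/-- A leaf `1 ≤ u ≤ 2t` has a twin: a vertex `x ≠ u` with `1 ≤ x ≤ 2t` in its class (`k ≥ 2t + 1`). -/
theorem exists_twin_starMatch (k t : ℕ) (hk : 2 * t + 1 ≤ k) (u : Fin k) (hu0 : u.val ≠ 0)
    (hu : u.val ≤ 2 * t) :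
    ∃ x : Fin k, x ≠ u ∧ x.val ≠ 0 ∧ x.val ≤ 2 * t ∧ (x.val + 1) / 2 = (u.val + 1) / 2 := by
  by_cases h : u.val % 2 = 1
  · refine ⟨⟨u.val + 1, by omega⟩, fun e => ?_, by simp, by simp; omega, by simp; omega⟩
    have := congrArg Fin.val e
    simp at this
  · refine ⟨⟨u.val - 1, by omega⟩, fun e => ?_, by simp; omega, by simp; omega, by simp; omega⟩
    have := congrArg Fin.val e
    simp at this
    omega

/-- A leaf `1 ≤ u ≤ 2t` has degree `2`: the centre and its twin (`k ≥ 2t + 1`). -/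
theorem deg_starMatch_leaf (k t : ℕ) (hk : 2 * t + 1 ≤ k) (u : Fin k) (hu0 : u.val ≠ 0) (hu : u.val ≤ 2 * t) :
    deg (starMatch k t) u = 2 := by
  have hle : deg (starMatch k t) u ≤ 2 := card_filter_adj_starMatch_leaf_le_two k t univ u hu0
  have hge : 2 ≤ deg (starMatch k t) u := by
    obtain ⟨x, h1, h2, h3, h4⟩ := exists_twin_starMatch k t hk u hu0 hu
    have hc : (⟨0, by omega⟩ : Fin k) ∈ univ.filter (fun x => (starMatch k t).Adj u x) := by
      rw [mem_filter, starMatch_adj]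
      exact ⟨mem_univ _, fun e => hu0 (by rw [e]), Or.inr (Or.inl rfl)⟩
    have hw : x ∈ univ.filter (fun x => (starMatch k t).Adj u x) := by
      rw [mem_filter, starMatch_adj]
      exact ⟨mem_univ _, h1.symm, Or.inr (Or.inr ⟨hu0, hu, h2, h3, h4.symm⟩)⟩
    have hne : (⟨0, by omega⟩ : Fin k) ≠ x := fun e => h2 (by rw [← e])
    unfold deg
    exact (card_pair hne).symm.le.trans (card_le_card (insert_subset hc (singleton_subset_iff.mpr hw)))
  omega

/-- A vertex `u > 2t` has degree `1`: the centre only. -/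
theorem deg_starMatch_far (k t : ℕ) (u : Fin k) (hu : 2 * t < u.val) : deg (starMatch k t) u = 1 := by
  have hu0 : u.val ≠ 0 := by omega
  have hle : deg (starMatch k t) u ≤ 1 := by
    apply card_filter_adj_starMatch_leaf_le_one k t univ u hu0
    intro x _ _ _ hx2 heq
    have hxu : x.val ≠ u.val := fun h => by omega
    omega
  have hge : 1 ≤ deg (starMatch k t) u := by
    unfold deg
    rw [Nat.one_le_iff_ne_zero, ← pos_iff_ne_zero, card_pos]
    exact ⟨⟨0, by omega⟩, by
      rw [mem_filter, starMatch_adj]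
      exact ⟨mem_univ _, fun e => hu0 (by rw [e]), Or.inr (Or.inl rfl)⟩⟩
  omega

/-- The degree of every vertex of `starMatch k t` (`k ≥ 2t + 1`), as a function of its value. -/
theorem deg_starMatch (k t : ℕ) (hk : 2 * t + 1 ≤ k) (v : Fin k) :
    deg (starMatch k t) v = if v.val = 0 then k - 1 else if v.val ≤ 2 * t then 2 else 1 := by
  split_ifs with h0 h2
  · exact deg_starMatch_centre k t v h0
  · exact deg_starMatch_leaf k t hk v h0 h2
  · exact deg_starMatch_far k t v (by omega)

/-- `Σ_v C(d(v), 2) = C(k − 1, 2) + 2t` on `starMatch k t` (`k ≥ 2t + 1`). -/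
theorem cherries_starMatch (k t : ℕ) (hk : 2 * t + 1 ≤ k) :
    cherries (starMatch k t) = (k - 1).choose 2 + 2 * t := by
  unfold cherries
  rw [sum_congr rfl (fun v _ => by rw [deg_starMatch k t hk v])]
  rw [Fin.sum_univ_eq_sum_range
    (fun i => (if i = 0 then k - 1 else if i ≤ 2 * t then 2 else 1).choose 2) k]
  obtain ⟨j, rfl⟩ : ∃ j, k = 2 * t + 1 + j := ⟨k - (2 * t + 1), by omega⟩
  rw [sum_range_add, sum_range_succ']
  have hrest : ∑ x ∈ range j,
      (if 2 * t + 1 + x = 0 then 2 * t + 1 + j - 1 else if 2 * t + 1 + x ≤ 2 * t then 2 else 1).choose 2 = 0 := by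
    apply sum_eq_zero
    intro x _
    rw [if_neg (by omega), if_neg (by omega)]
    rfl
  have hmid : ∑ x ∈ range (2 * t),
      (if x + 1 = 0 then 2 * t + 1 + j - 1 else if x + 1 ≤ 2 * t then 2 else 1).choose 2 = 2 * t := by
    have h1 : ∀ x ∈ range (2 * t),
        (if x + 1 = 0 then 2 * t + 1 + j - 1 else if x + 1 ≤ 2 * t then 2 else 1).choose 2 = 1 := by
      intro x hx
      rw [mem_range] at hx
      rw [if_neg (by omega), if_pos (by omega)]
      rfl
    rw [sum_congr rfl h1, sum_const, card_range, smul_eq_mul, mul_one]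
  rw [hrest, hmid, if_pos rfl]
  omega

/-- `Σ_v d(v) = 2k + 2t − 2` on `starMatch k t` (`k ≥ 2t + 1`). -/
theorem sum_deg_starMatch (k t : ℕ) (hk : 2 * t + 1 ≤ k) :
    ∑ v, deg (starMatch k t) v + 2 = 2 * k + 2 * t := by
  rw [sum_congr rfl (fun v _ => by rw [deg_starMatch k t hk v])]
  rw [Fin.sum_univ_eq_sum_range (fun i => if i = 0 then k - 1 else if i ≤ 2 * t then 2 else 1) k]
  obtain ⟨j, rfl⟩ : ∃ j, k = 2 * t + 1 + j := ⟨k - (2 * t + 1), by omega⟩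
  rw [sum_range_add, sum_range_succ']
  have hrest : ∑ x ∈ range j,
      (if 2 * t + 1 + x = 0 then 2 * t + 1 + j - 1 else if 2 * t + 1 + x ≤ 2 * t then 2 else 1) = j := by
    rw [sum_congr rfl (fun x _ => by rw [if_neg (by omega), if_neg (by omega)])]
    rw [sum_const, card_range, smul_eq_mul, mul_one]
  have hmid : ∑ x ∈ range (2 * t),
      (if x + 1 = 0 then 2 * t + 1 + j - 1 else if x + 1 ≤ 2 * t then 2 else 1) = 2 * (2 * t) := by
    have h1 : ∀ x ∈ range (2 * t),
        (if x + 1 = 0 then 2 * t + 1 + j - 1 else if x + 1 ≤ 2 * t then 2 else 1) = 2 := by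
      intro x hx
      rw [mem_range] at hx
      rw [if_neg (by omega), if_pos (by omega)]
    rw [sum_congr rfl h1, sum_const, card_range, smul_eq_mul, mul_comm]
  rw [hrest, hmid, if_pos rfl]
  omega

/-- `starMatch k t` has `k − 1 + t` edges (handshake; `k ≥ 2t + 1`). -/
theorem card_edges_starMatch (k t : ℕ) (hk : 2 * t + 1 ≤ k) :
    (starMatch k t).edgeFinset.card + 1 = k + t := by
  have h := sum_deg_eq (starMatch k t)
  have h2 := sum_deg_starMatch k t hk
  omega

/-- **THE STAR VALUE IS ATTAINED ON EVERY ROW:** for every `k ≥ 2t + 1` a `K₄⁻`-free graph on `Fin k` with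
`k − 1 + t` edges and `C(k − 1, 2) + 2t` cherries. -/
theorem exists_k4mFree_row_general (k t : ℕ) (hk : 2 * t + 1 ≤ k) :
    ∃ (D : SimpleGraph (Fin k)) (_ : DecidableRel D.Adj),
      K4mFree D ∧ D.edgeFinset.card + 1 = k + t ∧ cherries D = (k - 1).choose 2 + 2 * t :=
  ⟨starMatch k t, inferInstance, k4mFree_starMatch k t, card_edges_starMatch k t hk,
    cherries_starMatch k t hk⟩

/-- The threshold `t² + 6 ≤ 2k + t` with `t ≥ 4` implies `2t + 1 ≤ k`. -/
theorem two_mul_add_one_le_of_threshold (k t : ℕ) (ht : 4 ≤ t) (hk : t * t + 6 ≤ 2 * k + t) :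
    2 * t + 1 ≤ k := by
  obtain ⟨s, rfl⟩ : ∃ s, t = s + 4 := ⟨t - 4, by omega⟩
  ring_nf at hk
  omega

/-- **EVERY ROW `m = k − 1 + t`, `t ≥ 4`, ABOVE THE THRESHOLD IS SOLVED EXACTLY:** for `t ≥ 4` and
`t² + 6 ≤ 2k + t` every `K₄⁻`-free graph on `Fin k` with `k − 1 + t` edges has `Σ_v C(d(v), 2) ≤ C(k − 1, 2) + 2t`,
and the star plus `t` disjoint leaf edges attains it. -/
theorem row_general_exact (t : ℕ) (ht : 4 ≤ t) (k : ℕ) (hk : t * t + 6 ≤ 2 * k + t) :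
    (∀ (D : SimpleGraph (Fin k)) [DecidableRel D.Adj], K4mFree D → D.edgeFinset.card + 1 = k + t →
        cherries D ≤ (k - 1).choose 2 + 2 * t) ∧
      ∃ (D : SimpleGraph (Fin k)) (_ : DecidableRel D.Adj),
        K4mFree D ∧ D.edgeFinset.card + 1 = k + t ∧ cherries D = (k - 1).choose 2 + 2 * t := by
  refine ⟨fun D _ hK hD => ?_, exists_k4mFree_row_general k t (two_mul_add_one_le_of_threshold k t ht hk)⟩
  have := cherries_le_choose_two_add_two_mul_of_k4mFree t ht D hK (by simpa using hk) (by rw [hD]; simp)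
  simpa using this

end C047

end TriangleCap

end PercRepro
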